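import Summits.QuantumFields.YangMills.Theorems.BalabanUVNodesN11RePinnedOldBranchMeasurable
import Literature.MathematicalPhysics.QuantumFieldTheory.Balaban1983to89.Node00.Record13SepCoPHChi
import Literature.MathematicalPhysics.QuantumFieldTheory.Balaban1983to89.Node00.Record13ResidualsRChi
import Summits.QuantumFields.YangMills.Theorems.BalabanUVNodesN11HistoryPinnedResidualDefsChi
import Summits.QuantumFields.YangMills.Theorems.BalabanUVNodesN11RePinnedParamDefsChi
import Summits.QuantumFields.YangMills.Theorems.BalabanUVNodesN11NoExpansionAtRecord13CoPChi
import Summits.QuantumFields.YangMills.Theorems.BalabanUVNodesN11NoExpansionDiagonalCoPHChi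
import Summits.QuantumFields.YangMills.Theorems.BalabanUVNodesN11BackgroundScaleLocalChi
import Summits.QuantumFields.YangMills.Theorems.BalabanUVNodesN11NoExpansionOldFactorsChi
import Summits.QuantumFields.YangMills.Theorems.BalabanUVNodesN11NoExpansionGeneralStepCoPHOldBranchChi
import Summits.QuantumFields.YangMills.Theorems.BalabanUVNodesN11DiagonalOldBranchMeasurableChi
import Summits.QuantumFields.YangMills.Theorems.BalabanUVNodesN11NoExpansionOldBranchGraph
import Summits.QuantumFields.YangMills.Theorems.BalabanUVNodesN11NoExpansionGeneralStepGraphChi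

/-!
# χ-GENERIC RE-ISSUE (WORK ORDER RC-1) — MERGED MODULE `BalabanUVNodesN11OldBranchPairChi` holding the sibling twins of `BalabanUVNodesN11RePinnedOldBranchMeasurable`, `BalabanUVNodesN11NoExpansionOldBranchGraph`

(dag-n11-d g44, N11-σ chain; one file = fewer gate∕farm round-trips; each member keeps its own sibling namespace `…<Member>Chi` and its own header below.)
-/

/-!
# χ-GENERIC RE-ISSUE (WORK ORDER RC-1 «RE-CENTRE THE RECORD», director-ym №462 (B) ∕ №467 (D)) of `BalabanUVNodesN11RePinnedOldBranchMeasurable`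

Cell `pub-ymgap` (HUMAN RULING D-0062, Track A), seat `pub-ymgap-dag-n11-d` (N11 [B14] s2; N11-σ campaign, `N11-G44-RC1-REACH-CENSUS.md`).  The CENTRE-TYPED
declarations of `BalabanUVNodesN11RePinnedOldBranchMeasurable` (those whose statement reads the (2.9) cut-off centre through `gOfRecord₁₃ ∕ EOfRecord₁₃ ∕ Provisos₁₃… ∕ T∕SLaw₁₃… ∕
UbgOfRecord₁₃… ∕ WtOfRecord₁₃… ∕ datum∕tower∕coreOfRecord₁₃…`) RE-ISSUED VERBATIM in the β-slot `χ : ChiSlot F N` over [Ax-3b]∕[Ax-3c]∕[Ax-3d]'s χ-generic carriers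
(`Node00/Record13Chi` ∕ `Record13CoPHChi` ∕ `Record13SepCoPHChi`): σ = (binder `(χ : ChiSlot F N)` after `θ`; Node00 defs `X ↦ XChi … χ`; Node00 rows `Y ↦ Y_chi`;
this lane's sibling modules `…Chi` for Summits-side dependencies); SAME short names in the sibling namespace `…BalabanUVNodesN11RePinnedOldBranchMeasurableChi` (consumers switch by namespace);
the 6 centre-FREE declarations of the original are NOT copied — they are reused BY NAME (`open … (…)` below).  At `χ := chiβOfRecord₁₃ θ` every statement here is
DEFINITIONALLY the landed one ([Ax-3b]'s `rfl` receipts); at `χ := chiβOfRecord₁₃Ax θ` it is what the Ax-record's N11 machine reads.  Nothing of record edited (body-freeze №460 (2)).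

HONEST FRAMING.  Count-neutral kernel re-elaboration of landed N11 bookkeeping∕estimates in a parameter; every HYPOTHESIS of the original stays a hypothesis; nothing of
Bałaban asserted beyond what the original file proves; N11 NOT discharged; K-items untouched; counts unmoved.  One finite `𝕋⁴_{L^K}` programme at fixed `ε = L^{−K}` —
NOT ℝ⁴, NOT OS, NOT a mass gap, NOT Clay.  No `sorry`∕`instance`∕`notation`.  Sources: as the original module, plus [I] = [Balaban1987RG1] (2.9) p.266 (the cut-off's centre).
-/

noncomputable section

open MeasureTheory
open scoped BigOperators Matrix.Norms.L2Operator

namespace Summit.QuantumFields.YangMills.Theorems.BalabanUVNodesN11RePinnedOldBranchMeasurableChi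

open Summit.QuantumFields.YangMills.Theorems.BalabanUVNodesN11RePinnedOldBranchMeasurable (measurable_quad_ZhPinOfRecord₁₃ measurable_zhAt_quad_rePinH measurable_WtOfRecord₁₃H_rePinH_ζ measurable_WtOfRecord₁₃H_rePinH_w hmB_rePinH_of_measurable_operand hmB_rePinH_of_allLarge)
open Literature.MathematicalPhysics.QuantumFieldTheory.Balaban1983to89 T4Continuum Node00 Node00.Tk DagBinding
open B15DeterminingSets
open BalabanUVNodesN11TkOpMeasurable
open BalabanUVNodesN11DiagonalOldBranchMeasurable hiding measurable_WtOfRecord₁₃H_w measurable_WtOfRecord₁₃H_ζ measurable_stepWeightPinOfRecord₁₃ measurable_ζ0_ZrOfRecord₁₃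
open BalabanUVNodesN11DiagonalOldBranchMeasurableChi
open BalabanUVNodesN11HistoryPinnedResidualDefs hiding IsNoExpHistAt ZhPinOfRecord₁₃ ZhPinOfRecord₁₃_quad ZhPinOfRecord₁₃_ζ0_empty_of_hist ZhPinOfRecord₁₃_ζ0_of_hist_of_ne_of_ne ZhPinOfRecord₁₃_ζ0_of_not ZhPinOfRecord₁₃_ζ0_seqAllLarge ZhPinOfRecord₁₃_ζ0_univ_of_hist finsum_ζ0_ZhPinOfRecord₁₃ histPinOfRecord₁₃ histPinOfRecord₁₃_le_one histPinOfRecord₁₃_local histPinOfRecord₁₃_nonneg histPinOfRecord₁₃_pairCfg histPinOfRecord₁₃_pairCfgAt histPinOfRecord₁₃_seqAllLarge isNoExpHistAt_restrict isNoExpHistAt_self laws_ZhPinOfRecord₁₃ localLaws_ZhPinOfRecord₁₃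
open BalabanUVNodesN11HistoryPinnedResidualDefsChi
open BalabanUVNodesN11RePinnedParamDefs hiding rePinH zhAt_rePinH zhAt_rePinH_eq_init_of_Omega_empty zhAt_rePinH_ζ0_univ_pairCfgAt zhUnity_rePinH
open BalabanUVNodesN11RePinnedParamDefsChi
open BalabanUVNodesN11NoExpansionAllLargeCoP (init_allLarge)
open BalabanUVNodesN11NoExpansionGeneralStepCoPHOldBranchChi (measurable_chiSeqOfRecord_init)

variable {F : T4Family} {N : ℕ} [NeZero N]

/-! ## §1  The certificate residual has measurable `ζ0_j(Y)` -/

section Residual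

variable {θ χ : Stage13Params F N} {χ : ChiSlot F N} {p : B12.RunParams}

/-- **THE PIN VALUE OF A HISTORY IS MEASURABLE** given measurability of the old front factor `χ_j(init s)` and joint measurability of def-T's step weight `w_j(s)`
(it reads `((ω j).1, avg_j (ω j).1)`). [cite: Balaban1988Convergent, (2.17)–(2.18) p.257, (3.2)–(3.5) pp.264–265 (bookkeeping)] -/
theorem measurable_histPinOfRecord₁₃ (j : ℕ) (s : SeqOfRecord F θ.ν θ.τ9.M (gOfRecord₁₃Chi F N θ χ p) p.K (j + 1))
    (hχ : Measurable (chiSeqOfRecord F N θ.ν θ.τ9.M (gOfRecord₁₃Chi F N θ χ p) p.K j s.init))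
    (hmw : Measurable fun z : GaugeField (F.P p.K) (j + 1) (SU N) × GaugeField (F.P p.K) j (SU N) =>
      wOfRecord₉ F N θ.toStage9Params p (gOfRecord₁₃Chi F N θ χ p) j s z.2 z.1) :
    Measurable (histPinOfRecord₁₃ θ χ p j s) := by
  have hV : Measurable fun ω : MultiCfg (F.P p.K) (SU N) (FluctV N) => (ω j).1 := measurable_fst.comp (measurable_pi_apply j)
  have hg : Measurable fun ω : MultiCfg (F.P p.K) (SU N) (FluctV N) => ((avOfRecord F N p.K j).avg (ω j).1, (ω j).1) :=
    ((avOfRecord_measurable F N p.K j).comp hV).prodMk hV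
  have h1 := hχ.comp hV
  have h2 := hmw.comp hg
  exact h1.mul h2

open Classical in
/-- **★ THE CERTIFICATE FAMILY HAS MEASURABLE `ζ0_j(Y)`** for every `(j, Y)` and every raw set pair, given — below `K` — measurability of the old front factors and joint
measurability of def-T's step weights along every history (the no-expansion branch reads the history's pin value; everything else is K0a's residual, §1 of
`…N11DiagonalOldBranchMeasurable`). [cite: Balaban1988Convergent, p.267, (3.16)–(3.20) pp.268–269 (bookkeeping)] -/
theorem measurable_ζ0_ZhPinOfRecord₁₃
    (hχ : ∀ j, j < p.K → ∀ s : SeqOfRecord F θ.ν θ.τ9.M (gOfRecord₁₃Chi F N θ χ p) p.K (j + 1),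
      Measurable (chiSeqOfRecord F N θ.ν θ.τ9.M (gOfRecord₁₃Chi F N θ χ p) p.K j s.init))
    (hmw : ∀ j, j < p.K → ∀ s : SeqOfRecord F θ.ν θ.τ9.M (gOfRecord₁₃Chi F N θ χ p) p.K (j + 1),
      Measurable fun z : GaugeField (F.P p.K) (j + 1) (SU N) × GaugeField (F.P p.K) j (SU N) =>
        wOfRecord₉ F N θ.toStage9Params p (gOfRecord₁₃Chi F N θ χ p) j s z.2 z.1)
    (Ω Λ : ℕ → Set (Site (F.P p.K) 0)) (j : ℕ) (Y : Set (Site (F.P p.K) 0)) : Measurable ((ZhPinOfRecord₁₃ θ χ p Ω Λ).ζ0 j Y) := by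
  by_cases h : j < p.K ∧ ∃ s : SeqOfRecord F θ.ν θ.τ9.M (gOfRecord₁₃Chi F N θ χ p) p.K (j + 1), IsNoExpHistAt (θ := θ) (χ := χ) (p := p) Ω Λ j s
  · obtain ⟨hj, s, hs⟩ := h
    have hpin := measurable_histPinOfRecord₁₃ j s (hχ j hj s) (hmw j hj s)
    by_cases hT : Y = Set.univ
    · subst hT
      rw [show (ZhPinOfRecord₁₃ θ χ p Ω Λ).ζ0 j Set.univ = histPinOfRecord₁₃ θ χ p j s from funext fun ω => ZhPinOfRecord₁₃_ζ0_univ_of_hist hj hs ω]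
      exact hpin
    · by_cases h0 : Y = ∅
      · subst h0
        rw [show (ZhPinOfRecord₁₃ θ χ p Ω Λ).ζ0 j ∅ = fun ω => 1 - histPinOfRecord₁₃ θ χ p j s ω from funext fun ω => ZhPinOfRecord₁₃_ζ0_empty_of_hist hj hs ω]
        exact measurable_const.sub hpin
      · rw [show (ZhPinOfRecord₁₃ θ χ p Ω Λ).ζ0 j Y = fun _ => 0 from funext fun ω => ZhPinOfRecord₁₃_ζ0_of_hist_of_ne_of_ne hj hs hT h0 ω]
        exact measurable_const
  · rw [show (ZhPinOfRecord₁₃ θ χ p Ω Λ).ζ0 j Y = (ZrOfRecord₁₃Chi F N θ χ p).ζ0 j Y from funext fun ω => ZhPinOfRecord₁₃_ζ0_of_not h Y ω]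
    exact measurable_ζ0_ZrOfRecord₁₃ (fun j hj => hmw j hj _) j Y

end Residual

/-! ## §2  At the re-pinned parameter the residual and the 𝐓-weights serving any history are measurable (from `Provisos₁₃CoPH θ`) -/

section RePinned

variable (θ : Stage13HParams F N) (χ : ChiSlot F N) (p : B12.RunParams)

/-- **THE RESIDUAL SERVING ANY HISTORY AT `rePinH θ` HAS MEASURABLE `ζ0_j(Y)`**, from def-T's core provisos at `θ` (rows `measChi`, `tstep.measW`).
[cite: Balaban1988Convergent, (2.18) p.257, (3.2)–(3.9) pp.265–266, p.267 (bookkeeping)] -/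
theorem measurable_zhAt_ζ0_rePinH_of_provisos (h : θ.Provisos₁₃CoPHChi F N χ) {n : ℕ}
    (s : SeqOfRecord F θ.ν θ.τ9.M (gOfRecord₁₃Chi F N θ.toStage13Params χ p) p.K n) (j : ℕ) (Y : Set (Site (F.P p.K) 0)) :
    Measurable (((rePinH θ χ).zhAtChi χ p s).ζ0 j Y) := by
  rw [zhAt_rePinH]
  exact measurable_ζ0_ZhPinOfRecord₁₃ (θ := θ.toStage13Params) (χ := χ) (p := p) (fun j hj s' => measurable_chiSeqOfRecord_init θ χ p h hj s')
    (fun j hj s' => (h.tstep p j hj).measW s') s.Ω s.Λ j Y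

/-! ## §3  ★★ At `rePinH θ`, `hmB` for ANY no-expansion step reduces to measurability of the OPERAND alone -/

/-! ## §4  ★★ … and along the all-large-field diagonal it is discharged outright -/

end RePinned

end Summit.QuantumFields.YangMills.Theorems.BalabanUVNodesN11RePinnedOldBranchMeasurableChi

end



/-!
# χ-GENERIC RE-ISSUE (WORK ORDER RC-1 «RE-CENTRE THE RECORD», director-ym №462 (B) ∕ №467 (D)) of `BalabanUVNodesN11NoExpansionOldBranchGraph`

Cell `pub-ymgap` (HUMAN RULING D-0062, Track A), seat `pub-ymgap-dag-n11-d` (N11 [B14] s2; N11-σ campaign, `N11-G44-RC1-REACH-CENSUS.md`).  The CENTRE-TYPED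
declarations of `BalabanUVNodesN11NoExpansionOldBranchGraph` (those whose statement reads the (2.9) cut-off centre through `gOfRecord₁₃ ∕ EOfRecord₁₃ ∕ Provisos₁₃… ∕ T∕SLaw₁₃… ∕
UbgOfRecord₁₃… ∕ WtOfRecord₁₃… ∕ datum∕tower∕coreOfRecord₁₃…`) RE-ISSUED VERBATIM in the β-slot `χ : ChiSlot F N` over [Ax-3b]∕[Ax-3c]∕[Ax-3d]'s χ-generic carriers
(`Node00/Record13Chi` ∕ `Record13CoPHChi` ∕ `Record13SepCoPHChi`): σ = (binder `(χ : ChiSlot F N)` after `θ`; Node00 defs `X ↦ XChi … χ`; Node00 rows `Y ↦ Y_chi`;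
this lane's sibling modules `…Chi` for Summits-side dependencies); SAME short names in the sibling namespace `…BalabanUVNodesN11NoExpansionOldBranchGraphChi` (consumers switch by namespace);
the 1 centre-FREE declarations of the original are NOT copied — they are reused BY NAME (`open … (…)` below).  At `χ := chiβOfRecord₁₃ θ` every statement here is
DEFINITIONALLY the landed one ([Ax-3b]'s `rfl` receipts); at `χ := chiβOfRecord₁₃Ax θ` it is what the Ax-record's N11 machine reads.  Nothing of record edited (body-freeze №460 (2)).

HONEST FRAMING.  Count-neutral kernel re-elaboration of landed N11 bookkeeping∕estimates in a parameter; every HYPOTHESIS of the original stays a hypothesis; nothing of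
Bałaban asserted beyond what the original file proves; N11 NOT discharged; K-items untouched; counts unmoved.  One finite `𝕋⁴_{L^K}` programme at fixed `ε = L^{−K}` —
NOT ℝ⁴, NOT OS, NOT a mass gap, NOT Clay.  No `sorry`∕`instance`∕`notation`.  Sources: as the original module, plus [I] = [Balaban1987RG1] (2.9) p.266 (the cut-off's centre).
-/

noncomputable section

open MeasureTheory
open scoped BigOperators Matrix.Norms.L2Operator

namespace Summit.QuantumFields.YangMills.Theorems.BalabanUVNodesN11NoExpansionOldBranchGraphChi

open Summit.QuantumFields.YangMills.Theorems.BalabanUVNodesN11NoExpansionOldBranchGraph (clause_succ_rePinH_of_Omega_empty_of_oldBranch_of_clause_of_graph)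
open Literature.MathematicalPhysics.QuantumFieldTheory.Balaban1983to89 T4Continuum Node00 Node00.Tk DagBinding
open B15DeterminingSets
open BalabanUVNodesN11NoExpansionGeneralStepGraphChi (clause_succ_of_Omega_empty_of_prefix_of_clause_of_graph)
open BalabanUVNodesN11NoExpansionOldFactorsChi (oldFactors_agree_of_Omega_empty)
open BalabanUVNodesN11TkBranchWeightCongr (sect2Slot_congr_of_weights tkWeightsOfRecordP_ζ_congr tkWeightsOfRecordP_w_congr)
open BalabanUVNodesN11NoExpansionDiagonalAtZ (tkWeightsOfRecordP_ζ_apply tkWeightsOfRecordP_w_empty tkWeightsOfRecordP_ζ_local)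
open BalabanUVNodesN11NoExpansionDiagonalCoPHChi (WtOfRecord₁₃H_eq_tkWeightsOfRecordP)
open BalabanUVNodesN11NoExpansionGeneralStepCoPH (tkWeightsOfRecordP_w_local_of_quad_local)
open BalabanUVNodesN11NoExpansionGeneralStepCoPHOldBranchChi (newIntegrand_eq_of_pinChi measurable_chiSeqOfRecord_init)
open BalabanUVNodesN11RePinnedParamDefs hiding rePinH zhAt_rePinH zhAt_rePinH_eq_init_of_Omega_empty zhAt_rePinH_ζ0_univ_pairCfgAt zhUnity_rePinH
open BalabanUVNodesN11RePinnedParamDefsChi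

variable {F : T4Family} {N : ℕ} [NeZero N]

/-! ## §1  R4b′ — the v1.7 record, clause-keyed and provisos-keyed, graph-integrable, no measurability binder -/

section CoPH

variable (θ : Stage13HParams F N) (χ : ChiSlot F N) (p : B12.RunParams)

/-- **★★ THE NO-EXPANSION 𝐓-STEP AFTER AN ARBITRARY HISTORY AT THE v1.7 `CoPH` RECORD, CLAUSE-KEYED, GENERIC `θ : Stage13HParams`.**  See the module header:
`hid` at `init s′` (history's residual and weights of `init s′`) ⇒ the 𝐓-image clause at `s′` (history's residual and weights of `s′`), same `t`, same `E₀`, under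
(P) `hpre`, (V) `hZ` + `hq`, locality `hloc` ∕ `hqloc` ∕ `hA`, and graph-integrability `hI` (p563293's `hm` DROPPED). [cite: Balaban1988Convergent, Theorem p.245, (3.24)–(3.25) p.270, (2.18) p.257, (2.20)–(2.25) pp.258–259, (3.16) p.268; Balaban1989LargeFieldI, (0.2)–(0.3) p.176] -/
theorem clause_succ_CoPH_of_Omega_empty_of_pinChi_of_clause_of_graph {k : ℕ} (hk : k < p.K) (hM : 1 ≤ θ.τ9.M)
    (s : SeqOfRecord F θ.ν θ.τ9.M (gOfRecord₁₃Chi F N θ.toStage13Params χ p) p.K (k + 1)) (hΩ : s.Ω (k + 1) = ∅)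
    (hloc : (θ.zhAtChi χ p s).LocalLaws)
    (hqloc : ∀ j, j < k → ∀ ω ω' : MultiCfg (F.P p.K) (SU N) (FluctV N), (∀ i, i ≤ k → ω i = ω' i) →
      (θ.zhAtChi χ p s).quad j (s.init.Λ (j + 1)) ω = (θ.zhAtChi χ p s).quad j (s.init.Λ (j + 1)) ω')
    (hpre : ∀ j, j < k → (θ.zhAtChi χ p s).ζ0 j = (θ.zhAtChi χ p s.init).ζ0 j ∧ (θ.zhAtChi χ p s).quad j = (θ.zhAtChi χ p s.init).quad j)
    (t : Sect2.TermValues (F.P p.K) (MatA N) (FluctV N) θ.τ9.M) (E₀ : ℝ)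
    (hA : ∀ (S : ℕ → Set (Site (F.P p.K) 0)) (a a' : Tk.MSFluct (F.P p.K) (FluctV N)) (Uf : GaugeField (F.P p.K) 0 (SU N)), (∀ i, i ≤ k → a i = a' i) →
      (sect2ActionDataOfRecord F N (FluctV N) p.K (settingOfRecord₁₃Chi F N θ.toStage13Params χ p) (θ.rzAtChi χ p s.init) s.init t (S, a) E₀).action23 k Uf =
        (sect2ActionDataOfRecord F N (FluctV N) p.K (settingOfRecord₁₃Chi F N θ.toStage13Params χ p) (θ.rzAtChi χ p s.init) s.init t (S, a') E₀).action23 k Uf)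
    (hid : slotsOfRecord F N θ.ν θ.τ9 (EOfRecord₁₃Chi F N θ.toStage13Params χ) (wOfRecord₉ F N θ.toStage9Params) θ.ppSel p
        (gOfRecord₁₃Chi F N θ.toStage13Params χ p) k s.init = 0 ∨
      ∀ᵐ U₀ ∂fieldMeasure (F.P p.K) k (SU N),
        chiSeqOfRecord F N θ.ν θ.τ9.M (gOfRecord₁₃Chi F N θ.toStage13Params χ p) p.K k s.init U₀ ≠ 0 →
          slotsOfRecord F N θ.ν θ.τ9 (EOfRecord₁₃Chi F N θ.toStage13Params χ) (wOfRecord₉ F N θ.toStage9Params) θ.ppSel p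
              (gOfRecord₁₃Chi F N θ.toStage13Params χ p) k s.init U₀ =
            sect2Slot F N (FluctV N) p.K (settingOfRecord₁₃Chi F N θ.toStage13Params χ p) (θ.rzAtChi χ p s.init) (WtOfRecord₁₃HChi F N θ χ p s.init) s.init t E₀
              (UbgOfRecord₁₃CoPChi F N θ.toStage13Params χ p k s.init) U₀)
    (hZ : ∀ (V' : GaugeField (F.P p.K) (k + 1) (SU N)) (U₀ : GaugeField (F.P p.K) k (SU N)),
      (θ.zhAtChi χ p s).ζ0 k Set.univ (pairCfgAt (V := FluctV N) k V' U₀) =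
        chiSeqOfRecord F N θ.ν θ.τ9.M (gOfRecord₁₃Chi F N θ.toStage13Params χ p) p.K k s.init U₀ *
          wOfRecord₉ F N θ.toStage9Params p (gOfRecord₁₃Chi F N θ.toStage13Params χ p) k s U₀ ((avOfRecord F N p.K k).avg U₀))
    (hq : ∀ (V' : GaugeField (F.P p.K) (k + 1) (SU N)) (U₀ : GaugeField (F.P p.K) k (SU N)), (θ.zhAtChi χ p s).quad k ∅ (pairCfgAt (V := FluctV N) k V' U₀) = 0)
    (hI : ∀ S ∈ admSOfRecord F θ.ν θ.τ9.M (gOfRecord₁₃Chi F N θ.toStage13Params χ p) p.K k s.init,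
      Integrable (fun U₀ : GaugeField (F.P p.K) k (SU N) => noExpIntegrandAt F N (FluctV N) p.K k (WtOfRecord₁₃HChi F N θ χ p s)
        (tkBranchOfRecord F N (FluctV N) θ.ν θ.τ9.M _ p.K (WtOfRecord₁₃HChi F N θ χ p s) s.init S k
          (fun ω => sect2Operand F N (FluctV N) p.K (settingOfRecord₁₃Chi F N θ.toStage13Params χ p) (θ.rzAtChi χ p s) s t E₀
            (UbgOfRecord₁₃CoPChi F N θ.toStage13Params χ p (k + 1) s) (S, fun j => (ω j).2) (fun j => (ω j).1)))
        ((avOfRecord F N p.K k).avg U₀) U₀) (fieldMeasure (F.P p.K) k (SU N))) :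
    slotsTOfRecord F N θ.ν θ.τ9 (EOfRecord₁₃Chi F N θ.toStage13Params χ) (wOfRecord₉ F N θ.toStage9Params) θ.ppSel p
        (gOfRecord₁₃Chi F N θ.toStage13Params χ p) (k + 1) s = 0 ∨
      ∀ᵐ V' ∂fieldMeasure (F.P p.K) (k + 1) (SU N),
        chiSeqOfRecord F N θ.ν θ.τ9.M (gOfRecord₁₃Chi F N θ.toStage13Params χ p) p.K (k + 1) s V' ≠ 0 →
          slotsTOfRecord F N θ.ν θ.τ9 (EOfRecord₁₃Chi F N θ.toStage13Params χ) (wOfRecord₉ F N θ.toStage9Params) θ.ppSel p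
              (gOfRecord₁₃Chi F N θ.toStage13Params χ p) (k + 1) s V' =
            sect2Slot F N (FluctV N) p.K (settingOfRecord₁₃Chi F N θ.toStage13Params χ p) (θ.rzAtChi χ p s) (WtOfRecord₁₃HChi F N θ χ p s) s t E₀
              (UbgOfRecord₁₃CoPChi F N θ.toStage13Params χ p (k + 1) s) V' := by
  -- (P) at the level of 12a″'s weights: prefix agreement of `ζ_j`, `w_j`, `j < k`
  have hpre' : ∀ j, j < k → (WtOfRecord₁₃HChi F N θ χ p s).ζ j = (WtOfRecord₁₃HChi F N θ χ p s.init).ζ j ∧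
      (WtOfRecord₁₃HChi F N θ χ p s).w j = (WtOfRecord₁₃HChi F N θ χ p s.init).w j := fun j hj =>
    ⟨tkWeightsOfRecordP_ζ_congr θ.ν θ.A₁ p (gOfRecord₁₃Chi F N θ.toStage13Params χ p) (θ.zhAtChi χ p s) (θ.zhAtChi χ p s.init) j (hpre j hj).1,
      tkWeightsOfRecordP_w_congr θ.ν θ.A₁ p (gOfRecord₁₃Chi F N θ.toStage13Params χ p) (θ.zhAtChi χ p s) (θ.zhAtChi χ p s.init) j (hpre j hj).2⟩
  -- 12b locality of the history's residual ⇒ `k`-locality of `ζ_j`, `j < k`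
  have hζloc : ∀ j, j < k → ∀ ω ω' : MultiCfg (F.P p.K) (SU N) (FluctV N), (∀ i, i ≤ k → ω i = ω' i) →
      (WtOfRecord₁₃HChi F N θ χ p s).ζ j (s.init.Ω (j + 1))ᶜ ω = (WtOfRecord₁₃HChi F N θ χ p s).ζ j (s.init.Ω (j + 1))ᶜ ω' :=
    fun _ hj ω ω' h => hloc.localLaws₂.zeta0_local_lt hj _ ω ω' h
  -- 12a's A-side factor reads scales `j`, `j+1`; the residual's `quad_j` is `k`-local by `hqloc` ⇒ `w_j` is `k`-local, `j < k`
  have hwloc : ∀ (S : ℕ → Set (Site (F.P p.K) 0)) (j : ℕ), j < k → ∀ ω ω' : MultiCfg (F.P p.K) (SU N) (FluctV N), (∀ i, i ≤ k → ω i = ω' i) →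
      (WtOfRecord₁₃HChi F N θ χ p s).w j (s.init.Λ (j + 1)) ((s.init.Λ (j + 1))ᶜ ∩ s.init.Ω (j + 1)) (S (j + 1)) ω =
        (WtOfRecord₁₃HChi F N θ χ p s).w j (s.init.Λ (j + 1)) ((s.init.Λ (j + 1))ᶜ ∩ s.init.Ω (j + 1)) (S (j + 1)) ω' :=
    fun S j hj ω ω' h => tkWeightsOfRecordP_w_local_of_quad_local (θ.zhAtChi χ p s) hj _ _ _ (hqloc j hj) ω ω' h
  -- (V) the generation-`k` ζ-spec with the old front factor
  have hζχ : ∀ U₀ : GaugeField (F.P p.K) k (SU N),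
      (WtOfRecord₁₃HChi F N θ χ p s).ζ k Set.univ (pairCfgAt (V := FluctV N) k ((avOfRecord F N p.K k).avg U₀) U₀) *
          (WtOfRecord₁₃HChi F N θ χ p s).w k ∅ ∅ ∅ (pairCfgAt (V := FluctV N) k ((avOfRecord F N p.K k).avg U₀) U₀) =
        chiSeqOfRecord F N θ.ν θ.τ9.M (gOfRecord₁₃Chi F N θ.toStage13Params χ p) p.K k s.init U₀ *
          wOfRecord₉ F N θ.toStage9Params p (gOfRecord₁₃Chi F N θ.toStage13Params χ p) k s U₀ ((avOfRecord F N p.K k).avg U₀) := by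
    intro U₀
    rw [WtOfRecord₁₃H_eq_tkWeightsOfRecordP, tkWeightsOfRecordP_ζ_apply, tkWeightsOfRecordP_w_empty, hq, mul_zero, Real.exp_zero, mul_one]
    exact hZ _ _
  exact clause_succ_of_Omega_empty_of_prefix_of_clause_of_graph θ.toStage13Params χ p hk hM s hΩ (WtOfRecord₁₃HChi F N θ χ p s)
    (WtOfRecord₁₃HChi F N θ χ p s.init) hpre' hζloc hwloc (θ.rzAtChi χ p s.init) (θ.rzAtChi χ p s) t E₀ hA hid hζχ hI

/-- **… keyed on def-T's v1.7 core provisos** (`zhLocal` supplies `hloc`). [cite: Balaban1988Convergent, Theorem p.245, (3.24)–(3.25) p.270, (3.2)–(3.9) pp.265–266] -/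
theorem clause_succ_CoPH_of_Omega_empty_of_pinChi_of_provisos_of_clause_of_graph (h : θ.Provisos₁₃CoPHChi F N χ) {k : ℕ} (hk : k < p.K) (hM : 1 ≤ θ.τ9.M)
    (s : SeqOfRecord F θ.ν θ.τ9.M (gOfRecord₁₃Chi F N θ.toStage13Params χ p) p.K (k + 1)) (hΩ : s.Ω (k + 1) = ∅)
    (hqloc : ∀ j, j < k → ∀ ω ω' : MultiCfg (F.P p.K) (SU N) (FluctV N), (∀ i, i ≤ k → ω i = ω' i) →
      (θ.zhAtChi χ p s).quad j (s.init.Λ (j + 1)) ω = (θ.zhAtChi χ p s).quad j (s.init.Λ (j + 1)) ω')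
    (hpre : ∀ j, j < k → (θ.zhAtChi χ p s).ζ0 j = (θ.zhAtChi χ p s.init).ζ0 j ∧ (θ.zhAtChi χ p s).quad j = (θ.zhAtChi χ p s.init).quad j)
    (t : Sect2.TermValues (F.P p.K) (MatA N) (FluctV N) θ.τ9.M) (E₀ : ℝ)
    (hA : ∀ (S : ℕ → Set (Site (F.P p.K) 0)) (a a' : Tk.MSFluct (F.P p.K) (FluctV N)) (Uf : GaugeField (F.P p.K) 0 (SU N)), (∀ i, i ≤ k → a i = a' i) →
      (sect2ActionDataOfRecord F N (FluctV N) p.K (settingOfRecord₁₃Chi F N θ.toStage13Params χ p) (θ.rzAtChi χ p s.init) s.init t (S, a) E₀).action23 k Uf =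
        (sect2ActionDataOfRecord F N (FluctV N) p.K (settingOfRecord₁₃Chi F N θ.toStage13Params χ p) (θ.rzAtChi χ p s.init) s.init t (S, a') E₀).action23 k Uf)
    (hid : slotsOfRecord F N θ.ν θ.τ9 (EOfRecord₁₃Chi F N θ.toStage13Params χ) (wOfRecord₉ F N θ.toStage9Params) θ.ppSel p
        (gOfRecord₁₃Chi F N θ.toStage13Params χ p) k s.init = 0 ∨
      ∀ᵐ U₀ ∂fieldMeasure (F.P p.K) k (SU N),
        chiSeqOfRecord F N θ.ν θ.τ9.M (gOfRecord₁₃Chi F N θ.toStage13Params χ p) p.K k s.init U₀ ≠ 0 →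
          slotsOfRecord F N θ.ν θ.τ9 (EOfRecord₁₃Chi F N θ.toStage13Params χ) (wOfRecord₉ F N θ.toStage9Params) θ.ppSel p
              (gOfRecord₁₃Chi F N θ.toStage13Params χ p) k s.init U₀ =
            sect2Slot F N (FluctV N) p.K (settingOfRecord₁₃Chi F N θ.toStage13Params χ p) (θ.rzAtChi χ p s.init) (WtOfRecord₁₃HChi F N θ χ p s.init) s.init t E₀
              (UbgOfRecord₁₃CoPChi F N θ.toStage13Params χ p k s.init) U₀)
    (hZ : ∀ (V' : GaugeField (F.P p.K) (k + 1) (SU N)) (U₀ : GaugeField (F.P p.K) k (SU N)),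
      (θ.zhAtChi χ p s).ζ0 k Set.univ (pairCfgAt (V := FluctV N) k V' U₀) =
        chiSeqOfRecord F N θ.ν θ.τ9.M (gOfRecord₁₃Chi F N θ.toStage13Params χ p) p.K k s.init U₀ *
          wOfRecord₉ F N θ.toStage9Params p (gOfRecord₁₃Chi F N θ.toStage13Params χ p) k s U₀ ((avOfRecord F N p.K k).avg U₀))
    (hq : ∀ (V' : GaugeField (F.P p.K) (k + 1) (SU N)) (U₀ : GaugeField (F.P p.K) k (SU N)), (θ.zhAtChi χ p s).quad k ∅ (pairCfgAt (V := FluctV N) k V' U₀) = 0)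
    (hI : ∀ S ∈ admSOfRecord F θ.ν θ.τ9.M (gOfRecord₁₃Chi F N θ.toStage13Params χ p) p.K k s.init,
      Integrable (fun U₀ : GaugeField (F.P p.K) k (SU N) => noExpIntegrandAt F N (FluctV N) p.K k (WtOfRecord₁₃HChi F N θ χ p s)
        (tkBranchOfRecord F N (FluctV N) θ.ν θ.τ9.M _ p.K (WtOfRecord₁₃HChi F N θ χ p s) s.init S k
          (fun ω => sect2Operand F N (FluctV N) p.K (settingOfRecord₁₃Chi F N θ.toStage13Params χ p) (θ.rzAtChi χ p s) s t E₀
            (UbgOfRecord₁₃CoPChi F N θ.toStage13Params χ p (k + 1) s) (S, fun j => (ω j).2) (fun j => (ω j).1)))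
        ((avOfRecord F N p.K k).avg U₀) U₀) (fieldMeasure (F.P p.K) k (SU N))) :
    slotsTOfRecord F N θ.ν θ.τ9 (EOfRecord₁₃Chi F N θ.toStage13Params χ) (wOfRecord₉ F N θ.toStage9Params) θ.ppSel p
        (gOfRecord₁₃Chi F N θ.toStage13Params χ p) (k + 1) s = 0 ∨
      ∀ᵐ V' ∂fieldMeasure (F.P p.K) (k + 1) (SU N),
        chiSeqOfRecord F N θ.ν θ.τ9.M (gOfRecord₁₃Chi F N θ.toStage13Params χ p) p.K (k + 1) s V' ≠ 0 →
          slotsTOfRecord F N θ.ν θ.τ9 (EOfRecord₁₃Chi F N θ.toStage13Params χ) (wOfRecord₉ F N θ.toStage9Params) θ.ppSel p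
              (gOfRecord₁₃Chi F N θ.toStage13Params χ p) (k + 1) s V' =
            sect2Slot F N (FluctV N) p.K (settingOfRecord₁₃Chi F N θ.toStage13Params χ p) (θ.rzAtChi χ p s) (WtOfRecord₁₃HChi F N θ χ p s) s t E₀
              (UbgOfRecord₁₃CoPChi F N θ.toStage13Params χ p (k + 1) s) V' :=
  clause_succ_CoPH_of_Omega_empty_of_pinChi_of_clause_of_graph θ χ p hk hM s hΩ (h.zhLocal p (k + 1) s.Ω s.Λ) hqloc hpre t E₀ hA hid hZ hq hI

/-! ## §2  ★★ The OLD-BRANCH form (p547524 ∕ p563293) with INTEGRABILITY `hIB` of the old branch ALONE (`hmB` DROPPED) -/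

/-- **★★ THE GENERAL-HISTORY 𝐓-STEP AT THE v1.7 RECORD, OLD-BRANCH FORM** (p544575's provisos-keyed theorem with the measurability ∕ bound asked of the OLD branch
`U ↦ 𝐓_k(init s′, S)[e^{A_k(init s′)}](U)` only): `hid` at `init s′` ⇒ the 𝐓-image clause at `s′`, same `t`, same `E₀`, under (P) `hpre`, (V) `hZ`+`hq`, `hqloc`, `hA`,
`hIB` ALONE (`k < K`, `1 ≤ M`, `Provisos₁₃CoPH`; p563293's `hmB` DROPPED — its only use was the joint measurability of the new integrand, now read off the graph). [cite: Balaban1988Convergent, Theorem p.245, (3.24)–(3.25) p.270, (2.18) p.257, (2.20)–(2.25) pp.258–259, (3.16) p.268] -/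
theorem clause_succ_CoPH_of_Omega_empty_of_pinChi_of_oldBranch_of_clause_of_graph (h : θ.Provisos₁₃CoPHChi F N χ) {k : ℕ} (hk : k < p.K) (hM : 1 ≤ θ.τ9.M)
    (s : SeqOfRecord F θ.ν θ.τ9.M (gOfRecord₁₃Chi F N θ.toStage13Params χ p) p.K (k + 1)) (hΩ : s.Ω (k + 1) = ∅)
    (hqloc : ∀ j, j < k → ∀ ω ω' : MultiCfg (F.P p.K) (SU N) (FluctV N), (∀ i, i ≤ k → ω i = ω' i) →
      (θ.zhAtChi χ p s).quad j (s.init.Λ (j + 1)) ω = (θ.zhAtChi χ p s).quad j (s.init.Λ (j + 1)) ω')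
    (hpre : ∀ j, j < k → (θ.zhAtChi χ p s).ζ0 j = (θ.zhAtChi χ p s.init).ζ0 j ∧ (θ.zhAtChi χ p s).quad j = (θ.zhAtChi χ p s.init).quad j)
    (t : Sect2.TermValues (F.P p.K) (MatA N) (FluctV N) θ.τ9.M) (E₀ : ℝ)
    (hA : ∀ (S : ℕ → Set (Site (F.P p.K) 0)) (a a' : Tk.MSFluct (F.P p.K) (FluctV N)) (Uf : GaugeField (F.P p.K) 0 (SU N)), (∀ i, i ≤ k → a i = a' i) →
      (sect2ActionDataOfRecord F N (FluctV N) p.K (settingOfRecord₁₃Chi F N θ.toStage13Params χ p) (θ.rzAtChi χ p s.init) s.init t (S, a) E₀).action23 k Uf =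
        (sect2ActionDataOfRecord F N (FluctV N) p.K (settingOfRecord₁₃Chi F N θ.toStage13Params χ p) (θ.rzAtChi χ p s.init) s.init t (S, a') E₀).action23 k Uf)
    (hid : slotsOfRecord F N θ.ν θ.τ9 (EOfRecord₁₃Chi F N θ.toStage13Params χ) (wOfRecord₉ F N θ.toStage9Params) θ.ppSel p
        (gOfRecord₁₃Chi F N θ.toStage13Params χ p) k s.init = 0 ∨
      ∀ᵐ U₀ ∂fieldMeasure (F.P p.K) k (SU N),
        chiSeqOfRecord F N θ.ν θ.τ9.M (gOfRecord₁₃Chi F N θ.toStage13Params χ p) p.K k s.init U₀ ≠ 0 →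
          slotsOfRecord F N θ.ν θ.τ9 (EOfRecord₁₃Chi F N θ.toStage13Params χ) (wOfRecord₉ F N θ.toStage9Params) θ.ppSel p
              (gOfRecord₁₃Chi F N θ.toStage13Params χ p) k s.init U₀ =
            sect2Slot F N (FluctV N) p.K (settingOfRecord₁₃Chi F N θ.toStage13Params χ p) (θ.rzAtChi χ p s.init) (WtOfRecord₁₃HChi F N θ χ p s.init) s.init t E₀
              (UbgOfRecord₁₃CoPChi F N θ.toStage13Params χ p k s.init) U₀)
    (hZ : ∀ (V' : GaugeField (F.P p.K) (k + 1) (SU N)) (U₀ : GaugeField (F.P p.K) k (SU N)),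
      (θ.zhAtChi χ p s).ζ0 k Set.univ (pairCfgAt (V := FluctV N) k V' U₀) =
        chiSeqOfRecord F N θ.ν θ.τ9.M (gOfRecord₁₃Chi F N θ.toStage13Params χ p) p.K k s.init U₀ *
          wOfRecord₉ F N θ.toStage9Params p (gOfRecord₁₃Chi F N θ.toStage13Params χ p) k s U₀ ((avOfRecord F N p.K k).avg U₀))
    (hq : ∀ (V' : GaugeField (F.P p.K) (k + 1) (SU N)) (U₀ : GaugeField (F.P p.K) k (SU N)), (θ.zhAtChi χ p s).quad k ∅ (pairCfgAt (V := FluctV N) k V' U₀) = 0)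
    (hIB : ∀ S ∈ admSOfRecord F θ.ν θ.τ9.M (gOfRecord₁₃Chi F N θ.toStage13Params χ p) p.K k s.init,
      Integrable (fun U₀ : GaugeField (F.P p.K) k (SU N) =>
        tkBranchOfRecord F N (FluctV N) θ.ν θ.τ9.M _ p.K (WtOfRecord₁₃HChi F N θ χ p s) s.init S k
          (fun ω => sect2Operand F N (FluctV N) p.K (settingOfRecord₁₃Chi F N θ.toStage13Params χ p) (θ.rzAtChi χ p s.init) s.init t E₀
            (UbgOfRecord₁₃CoPChi F N θ.toStage13Params χ p k s.init) (S, fun j => (ω j).2) (fun j => (ω j).1))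
          (baseCfg (V := FluctV N) k U₀)) (fieldMeasure (F.P p.K) k (SU N))) :
    slotsTOfRecord F N θ.ν θ.τ9 (EOfRecord₁₃Chi F N θ.toStage13Params χ) (wOfRecord₉ F N θ.toStage9Params) θ.ppSel p
        (gOfRecord₁₃Chi F N θ.toStage13Params χ p) (k + 1) s = 0 ∨
      ∀ᵐ V' ∂fieldMeasure (F.P p.K) (k + 1) (SU N),
        chiSeqOfRecord F N θ.ν θ.τ9.M (gOfRecord₁₃Chi F N θ.toStage13Params χ p) p.K (k + 1) s V' ≠ 0 →
          slotsTOfRecord F N θ.ν θ.τ9 (EOfRecord₁₃Chi F N θ.toStage13Params χ) (wOfRecord₉ F N θ.toStage9Params) θ.ppSel p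
              (gOfRecord₁₃Chi F N θ.toStage13Params χ p) (k + 1) s V' =
            sect2Slot F N (FluctV N) p.K (settingOfRecord₁₃Chi F N θ.toStage13Params χ p) (θ.rzAtChi χ p s) (WtOfRecord₁₃HChi F N θ χ p s) s t E₀
              (UbgOfRecord₁₃CoPChi F N θ.toStage13Params χ p (k + 1) s) V' := by
  -- abbreviations: the old front factor, the graph step weight, the old branch
  set χk : GaugeField (F.P p.K) k (SU N) → ℝ := chiSeqOfRecord F N θ.ν θ.τ9.M (gOfRecord₁₃Chi F N θ.toStage13Params χ p) p.K k s.init with hχk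
  set wg : GaugeField (F.P p.K) k (SU N) → ℝ := fun U₀ =>
    wOfRecord₉ F N θ.toStage9Params p (gOfRecord₁₃Chi F N θ.toStage13Params χ p) k s U₀ ((avOfRecord F N p.K k).avg U₀) with hwg
  have hχm : Measurable χk := measurable_chiSeqOfRecord_init θ χ p h hk s
  have hwm : Measurable wg := by
    have hg : Measurable fun U₀ : GaugeField (F.P p.K) k (SU N) => ((avOfRecord F N p.K k).avg U₀, U₀) :=
      (avOfRecord_measurable F N p.K k).prodMk measurable_id
    simpa only [hwg, Function.comp_def] using ((h.tstep p k hk).measW s).comp hg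
  -- the closed form of the new integrand per old branch
  have hnew : ∀ (S : ℕ → Set (Site (F.P p.K) 0)) (V' : GaugeField (F.P p.K) (k + 1) (SU N)) (U₀ : GaugeField (F.P p.K) k (SU N)),
      noExpIntegrandAt F N (FluctV N) p.K k (WtOfRecord₁₃HChi F N θ χ p s)
          (tkBranchOfRecord F N (FluctV N) θ.ν θ.τ9.M _ p.K (WtOfRecord₁₃HChi F N θ χ p s) s.init S k
            (fun ω => sect2Operand F N (FluctV N) p.K (settingOfRecord₁₃Chi F N θ.toStage13Params χ p) (θ.rzAtChi χ p s) s t E₀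
              (UbgOfRecord₁₃CoPChi F N θ.toStage13Params χ p (k + 1) s) (S, fun j => (ω j).2) (fun j => (ω j).1)))
          V' U₀ =
        χk U₀ * wg U₀ *
          tkBranchOfRecord F N (FluctV N) θ.ν θ.τ9.M _ p.K (WtOfRecord₁₃HChi F N θ χ p s) s.init S k
            (fun ω => sect2Operand F N (FluctV N) p.K (settingOfRecord₁₃Chi F N θ.toStage13Params χ p) (θ.rzAtChi χ p s.init) s.init t E₀
              (UbgOfRecord₁₃CoPChi F N θ.toStage13Params χ p k s.init) (S, fun j => (ω j).2) (fun j => (ω j).1))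
            (baseCfg (V := FluctV N) k U₀) := fun S V' U₀ =>
    newIntegrand_eq_of_pinChi θ χ p hM s hΩ (h.zhLocal p (k + 1) s.Ω s.Λ) hqloc t E₀ S (hA S) hZ hq V' U₀
  refine clause_succ_CoPH_of_Omega_empty_of_pinChi_of_provisos_of_clause_of_graph θ χ p h hk hM s hΩ hqloc hpre t E₀ hA hid hZ hq
    (fun S hS => ?_)
  · -- graph-integrability: `|χ·w| ≤ 1` times the integrable old branch
    have heq : (fun U₀ : GaugeField (F.P p.K) k (SU N) => noExpIntegrandAt F N (FluctV N) p.K k (WtOfRecord₁₃HChi F N θ χ p s)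
        (tkBranchOfRecord F N (FluctV N) θ.ν θ.τ9.M _ p.K (WtOfRecord₁₃HChi F N θ χ p s) s.init S k
          (fun ω => sect2Operand F N (FluctV N) p.K (settingOfRecord₁₃Chi F N θ.toStage13Params χ p) (θ.rzAtChi χ p s) s t E₀
            (UbgOfRecord₁₃CoPChi F N θ.toStage13Params χ p (k + 1) s) (S, fun j => (ω j).2) (fun j => (ω j).1)))
        ((avOfRecord F N p.K k).avg U₀) U₀) =
        fun U₀ => tkBranchOfRecord F N (FluctV N) θ.ν θ.τ9.M _ p.K (WtOfRecord₁₃HChi F N θ χ p s) s.init S k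
            (fun ω => sect2Operand F N (FluctV N) p.K (settingOfRecord₁₃Chi F N θ.toStage13Params χ p) (θ.rzAtChi χ p s.init) s.init t E₀
              (UbgOfRecord₁₃CoPChi F N θ.toStage13Params χ p k s.init) (S, fun j => (ω j).2) (fun j => (ω j).1))
            (baseCfg (V := FluctV N) k U₀) * (χk U₀ * wg U₀) := by
      funext U₀
      rw [hnew S _ U₀]
      ring
    rw [heq]
    refine (hIB S hS).mul_bdd (hχm.mul hwm).aestronglyMeasurable (c := 1) (Filter.Eventually.of_forall fun U₀ => ?_)
    rw [Real.norm_eq_abs, abs_mul]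
    have h1 : |χk U₀| ≤ 1 := abs_chiSeqOfRecord_le_one F N θ.ν θ.τ9.M _ p.K k s.init U₀
    have h2 : |wg U₀| ≤ 1 := (h.tstep p k hk).absW_le s U₀ _
    calc |χk U₀| * |wg U₀| ≤ 1 * 1 := mul_le_mul h1 h2 (abs_nonneg _) zero_le_one
      _ = 1 := one_mul 1

end CoPH

/-! ## §3  ★★★ At the re-pinned parameter `rePinH θ` (p553094 §3 ∕ p569094's first theorem) with `hmB` DROPPED -/

end Summit.QuantumFields.YangMills.Theorems.BalabanUVNodesN11NoExpansionOldBranchGraphChi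

end

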